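import Summits.BirchSwinnertonDyer.Rank1Residual.ManinAdditive.TypeThreeSubgroupCharacter
import Summits.BirchSwinnertonDyer.Rank1Residual.GaloisImage.TameThreeKodairaShapeInt
import Summits.BirchSwinnertonDyer.Rank1Residual.Additive.GordKodairaType
import Literature.NumberTheory.EllipticCurves.SzpiroLocalDataProofs
import Literature.NumberTheory.DiophantineGeometry.TateAlgorithmProofs
import Mathlib.NumberTheory.Padics.RingHoms
import HarnessLib

/-!
# The Newton polygon of `ψ₃` at a Kodaira type `III` prime `3`: `9 ∥ N`, `v₃ Δ_min = 3` ⟹ an integer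
# `III`-shape translate, and the unique `3`-adic unit root of `ψ₃ = 3z⁴ + 3βz³ + 9γz² + 27δz + 9ε`

Summit `BirchSwinnertonDyer`, route `ManinLocalTwoThree` (cell bsd-f2-manin), crux C3 `ManinPrimeToThreeAtNine`
(stmt-BirchSwinnertonDyer-22968), the `W[3]`-reducible residual at a TAME additive `3` (Kodaira type `III`,
`9 ∥ N`, `v₃ Δ_min = 3`).  TOOL theorems for the two typed tame-`3` laws of
`Rank1Residual/ManinAdditive/TypeThreeSubgroupCharacter.lean` — E-imc-71 `TypeThreeSubgroupCharacterUnramified`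
and E-imc-76u `TameThreeIIIAtMostOneLocalLine` (proved by name in the sibling file
`ManinLocalTwoThreeTameThreeSubgroupLaws.lean`):

* §1 `kodairaSymbolAt_placeOf_three_eq_III` — `9 ∥ N_E` and `ord₃ Δ_min = 3` force Kodaira type `III` at the
  place `(3)` of `ℤ`: the tree's conductor exponent IS Ogg's formula `f = ord Δ_min + 1 − m`
  (`WeierstrassCurve.conductorExponent`), so `m = 2`, and `I₂` is excluded by `kodairaSymbolAt_eq_I_iff_holds`
  (`ord Δ_min (I₂) = 2`);
* §2 the `3`-ADIC CORE (Newton polygon of the type-`III` quartic by hand, `β γ δ ε : ℤ`, `3 ∤ ε`):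
  `isUnit_of_psi3III_root` / `norm_le_one_of_psi3III_root` / `norm_eq_one_of_psi3III_root` — every root in `ℚ₃`
  of `3x⁴ + 3βx³ + 9γx² + 27δx + 9ε` is a `3`-adic unit; `three_dvd_add_of_psi3III_root` — a unit root is
  `≡ −β (mod 3)`; `eq_of_psi3III_roots` — two unit roots coincide (`F(z + 3t) − F(z) = 9t·Q`, `Q ≡ 4z³ (mod 3)`
  a unit, `ℤ₃` a domain); `isUnit_disc_of_isUnit` — `4z³ + 3βz² + 6γz + 9δ` is a unit;
* §3 `exists_IIIShape_coeffs_three` — Tate's normal form read on INTEGERS: `b₂(W) = 3β − 12r`,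
  `b₄(W) = 3γ − 3βr + 6r²`, `b₆(W) = 9δ − 6γr + 3βr² − 4r³`, `b₈(W) = 9ε − 27δr + 9γr² − 3βr³ + 3r⁴` with
  `3 ∤ ε`, from the tree's K1 bridge `GaloisImage.exists_IIIShape_intModel_three'` (an integer translate
  `x ↦ x + r` with `3 ∣ b₂`, `3 ∥ b₄`, `9 ∣ b₆`) and `4b₈ = b₂b₆ − b₄²`; so `ψ₃^W(x) = F(x − r)` and
  `ψ₂²^W(x) = 4(x−r)³ + 3β(x−r)² + 6γ(x−r) + 9δ`.

No new definitions, no named fact, no sorry.  Nothing about BSD or Manin's conjecture is proved here.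

References: J. H. Silverman, *ATAEC* IV.9.4 Steps 2–4 and Table 4.1 (Tate's algorithm, type `III`),
IV.11.1 (Ogg's formula) [cite: SilvermanATAEC1994, IV.9.4 and Table 4.1]; J. Tate, LNM 476 (1975) §§7–8;
cell memos HOME/MEMO-imc.md §19.15, §20.4 and HOME/REFUTER-ref1.md §R52, §R54 (statement audit, census
8 650 / 8 650 and 77 415 / 77 415).
-/

set_option linter.dupNamespace false

noncomputable section

open scoped Classical

open WeierstrassCurve IsDedekindDomain Rat.HeightOneSpectrum
  Literature.NumberTheory.DiophantineGeometry Literature.NumberTheory.EllipticCurves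
  Summit.BirchSwinnertonDyer.Rank1Residual.Additive
  Summit.BirchSwinnertonDyer.Rank1Residual.ManinAdditive.TameThreeCharacter

namespace Summit.BirchSwinnertonDyer.BirchSwinnertonDyer.Theorems.ManinLocalTwoThree

/-! ### §1. `9 ∥ N` and `v₃ Δ_min = 3` give Kodaira type `III` at `3` -/

/-- `9 ∥ N_E` and `ord₃ Δ_min = 3` force Kodaira type `III` at the place `(3)`: the tree's conductor
exponent IS Ogg's formula `f = ord Δ_min + 1 − m`, so `m = 2`, i.e. the symbol is `I₂` or `III`, and
`I₂` would have `ord₃ Δ_min = 2` (`kodairaSymbolAt_eq_I_iff_holds`).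
[cite: SilvermanATAEC1994, IV.9.4 Table 4.1 and IV.11.1 (Ogg's formula)] -/
theorem kodairaSymbolAt_placeOf_three_eq_III (W : WeierstrassCurve ℚ) [W.IsElliptic]
    [W.IsGloballyMinimal] (h9 : 3 ^ 2 ∣ W.conductorNorm ℤ) (h27 : ¬ 3 ^ 3 ∣ W.conductorNorm ℤ)
    (hΔ : padicValInt 3 W.minimalDiscriminantInt = 3) :
    W.kodairaSymbolAt (placeOf 3) = .III := by
  have hN0 : W.conductorNorm ℤ ≠ 0 := fun h ↦ h27 (h ▸ dvd_zero _)
  have hf : (W.conductorNorm ℤ).factorization 3 = 2 := by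
    have h2 : 2 ≤ (W.conductorNorm ℤ).factorization 3 :=
      (Nat.prime_three.pow_dvd_iff_le_factorization hN0).mp h9
    have h3 : ¬ 3 ≤ (W.conductorNorm ℤ).factorization 3 := fun h ↦
      h27 ((Nat.prime_three.pow_dvd_iff_le_factorization hN0).mpr h)
    omega
  have hcond : W.conductorExponent (placeOf 3) = 2 := by
    rw [← hf]; exact (factorization_conductorNorm_primesEquiv_symm W ⟨3, Nat.prime_three⟩).symm
  have hord : W.ordMinimalDiscriminant (placeOf 3) = 3 := by
    rw [ordMinimalDiscriminant_placeOf_eq]; exact_mod_cast hΔ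
  have hm : (W.kodairaSymbolAt (placeOf 3)).numComponents = 2 := by
    unfold WeierstrassCurve.conductorExponent WeierstrassCurve.numComponentsAt at hcond
    omega
  have key : ∀ s : KodairaSymbol, s.numComponents = 2 → s = .I 2 ∨ s = .III := by
    rintro ((_ | n) | _ | _ | _ | n | _ | _ | _) hs <;>
      simp only [KodairaSymbol.numComponents] at hs
    all_goals first
      | omega
      | exact Or.inr rfl
      | (obtain rfl : n = 1 := by omega
         exact Or.inl rfl)
  rcases key _ hm with h2 | h3
  · -- `I₂` is multiplicative with `ord₃ Δ_min = 2`, contradicting `ord₃ Δ_min = 3`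
    have := ((kodairaSymbolAt_eq_I_iff_holds (placeOf 3) W) two_ne_zero).mp h2
    omega
  · exact h3

/-! ### §2. The `3`-adic core: roots of `Ψ₃ = 3z⁴ + 3βz³ + 9γz² + 27δz + 9ε`, `3 ∤ ε` -/

section Core

variable {β γ δ ε : ℤ}

/-- `toZMod 3 = 0` in `ZMod 3`. -/
private theorem toZMod_three : PadicInt.toZMod (3 : ℤ_[3]) = 0 := by
  rw [map_ofNat]; decide

/-- In `ℤ₃`, `3 ∣ a` iff `toZMod a = 0`. -/
private theorem three_dvd_iff_toZMod_eq_zero (a : ℤ_[3]) :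
    (3 : ℤ_[3]) ∣ a ↔ PadicInt.toZMod a = 0 := by
  rw [← RingHom.mem_ker, PadicInt.ker_toZMod, PadicInt.maximalIdeal_eq_span_p,
    Ideal.mem_span_singleton]
  norm_num

/-- In `ℤ₃`, an element with non-zero reduction mod `3` is a unit. -/
private theorem isUnit_of_toZMod_ne_zero {a : ℤ_[3]} (h : PadicInt.toZMod a ≠ 0) : IsUnit a := by
  by_contra hu
  have hmem : a ∈ IsLocalRing.maximalIdeal ℤ_[3] := hu
  rw [← PadicInt.ker_toZMod, RingHom.mem_ker] at hmem
  exact h hmem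

/-- A unit of `ℤ₃` has non-zero reduction mod `3`. -/
private theorem toZMod_ne_zero_of_isUnit {a : ℤ_[3]} (h : IsUnit a) : PadicInt.toZMod a ≠ 0 :=
  (h.map PadicInt.toZMod).ne_zero

/-- For an integer `n`: `3 ∣ (n : ℤ₃)` iff `3 ∣ n`. -/
private theorem three_dvd_intCast_iff (n : ℤ) : (3 : ℤ_[3]) ∣ (n : ℤ_[3]) ↔ (3 : ℤ) ∣ n := by
  have h := PadicInt.pow_p_dvd_int_iff (p := 3) 1 n
  simp only [pow_one, Nat.cast_ofNat] at h
  exact_mod_cast h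

/-- **Integrality half of the Newton polygon.** A `3`-adic INTEGER root of
`3z⁴ + 3βz³ + 9γz² + 27δz + 9ε` with `3 ∤ ε` is a unit: if `3 ∣ z` every term but `9ε` is divisible
by `27`. [cite: SilvermanATAEC1994, IV.9.4 Step 4 (type III: π³ ∤ b₈)] -/
theorem isUnit_of_psi3III_root (hε : ¬ (3 : ℤ) ∣ ε) {z : ℤ_[3]}
    (hz : 3 * z ^ 4 + 3 * β * z ^ 3 + 9 * γ * z ^ 2 + 27 * δ * z + 9 * ε = 0) : IsUnit z := by
  by_contra hu
  have hlt : ‖z‖ < 1 := PadicInt.not_isUnit_iff.mp hu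
  obtain ⟨w, hw⟩ : (3 : ℤ_[3]) ∣ z := by
    have := (PadicInt.norm_lt_one_iff_dvd z).mp hlt
    simpa only [Nat.cast_ofNat] using this
  apply hε
  rw [← three_dvd_intCast_iff]
  refine ⟨-(9 * w ^ 4 + 3 * β * w ^ 3 + 3 * γ * w ^ 2 + 3 * δ * w), ?_⟩
  have h9 : (9 : ℤ_[3]) ≠ 0 := by norm_num
  apply mul_left_cancel₀ h9
  rw [hw] at hz
  linear_combination hz

/-- **No root of negative valuation.** A root `x ∈ ℚ₃` of `3x⁴ + 3βx³ + 9γx² + 27δx + 9ε` is a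
`3`-adic integer: if `|x| > 1` then `y = 1/x ∈ 3ℤ₃` and `3 + 3βy + 9γy² + 27δy³ + 9εy⁴ = 0` gives
`3 ∣ 1` in `ℤ₃`. [cite: SilvermanATAEC1994, IV.9.4 Step 4] -/
theorem norm_le_one_of_psi3III_root {x : ℚ_[3]}
    (hx : 3 * x ^ 4 + 3 * (β : ℚ_[3]) * x ^ 3 + 9 * (γ : ℚ_[3]) * x ^ 2 + 27 * (δ : ℚ_[3]) * x
      + 9 * (ε : ℚ_[3]) = 0) : ‖x‖ ≤ 1 := by
  by_contra hgt
  push Not at hgt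
  have hx0 : x ≠ 0 := by
    rintro rfl; norm_num at hgt
  have hy : ‖x⁻¹‖ < 1 := by
    rw [norm_inv]; exact inv_lt_one_of_one_lt₀ hgt
  set z : ℤ_[3] := ⟨x⁻¹, hy.le⟩ with hzdef
  obtain ⟨w, hw⟩ : (3 : ℤ_[3]) ∣ z := by
    have := (PadicInt.norm_lt_one_iff_dvd z).mp hy
    simpa only [Nat.cast_ofNat] using this
  -- the reciprocal equation, in `ℚ₃` then in `ℤ₃`
  have e1 : x * x⁻¹ = 1 := mul_inv_cancel₀ hx0
  have hrec : (3 : ℚ_[3]) + 3 * β * x⁻¹ + 9 * γ * x⁻¹ ^ 2 + 27 * δ * x⁻¹ ^ 3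
      + 9 * ε * x⁻¹ ^ 4 = 0 := by
    linear_combination x⁻¹ ^ 4 * hx
      - (3 * (1 + x * x⁻¹ + x ^ 2 * x⁻¹ ^ 2 + x ^ 3 * x⁻¹ ^ 3)
          + 3 * (β : ℚ_[3]) * x⁻¹ * (1 + x * x⁻¹ + x ^ 2 * x⁻¹ ^ 2)
          + 9 * (γ : ℚ_[3]) * x⁻¹ ^ 2 * (1 + x * x⁻¹) + 27 * (δ : ℚ_[3]) * x⁻¹ ^ 3) * e1
  have hz : (3 : ℤ_[3]) + 3 * (β : ℤ_[3]) * z + 9 * (γ : ℤ_[3]) * z ^ 2 + 27 * (δ : ℤ_[3]) * z ^ 3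
      + 9 * (ε : ℤ_[3]) * z ^ 4 = 0 := by
    have hzx : (z : ℚ_[3]) = x⁻¹ := rfl
    rw [← PadicInt.coe_eq_zero]
    push_cast [hzx]
    exact hrec
  rw [hw] at hz
  have h3 : (3 : ℤ_[3]) ≠ 0 := by norm_num
  have hunit : IsUnit (3 : ℤ_[3]) := by
    refine isUnit_of_dvd_one ⟨-(β * w + 9 * γ * w ^ 2 + 81 * δ * w ^ 3 + 81 * ε * w ^ 4), ?_⟩
    apply mul_left_cancel₀ h3
    linear_combination hz
  have hnon := PadicInt.p_nonunit (p := 3)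
  rw [Nat.cast_ofNat] at hnon
  exact hnon hunit

/-- **The valuation-`0` vertex of the Newton polygon**: every root `x ∈ ℚ₃` of
`3x⁴ + 3βx³ + 9γx² + 27δx + 9ε` (`3 ∤ ε`) is a `3`-adic unit, `|x|₃ = 1`.
[cite: SilvermanATAEC1994, IV.9.4 Step 4] -/
theorem norm_eq_one_of_psi3III_root (hε : ¬ (3 : ℤ) ∣ ε) {x : ℚ_[3]}
    (hx : 3 * x ^ 4 + 3 * (β : ℚ_[3]) * x ^ 3 + 9 * (γ : ℚ_[3]) * x ^ 2 + 27 * (δ : ℚ_[3]) * x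
      + 9 * (ε : ℚ_[3]) = 0) : ‖x‖ = 1 := by
  have hle := norm_le_one_of_psi3III_root hx
  set z : ℤ_[3] := ⟨x, hle⟩ with hzdef
  have hz : 3 * z ^ 4 + 3 * (β : ℤ_[3]) * z ^ 3 + 9 * (γ : ℤ_[3]) * z ^ 2 + 27 * (δ : ℤ_[3]) * z
      + 9 * (ε : ℤ_[3]) = 0 := by
    have hzx : (z : ℚ_[3]) = x := rfl
    rw [← PadicInt.coe_eq_zero]
    push_cast [hzx]
    exact hx
  have hu := isUnit_of_psi3III_root hε hz
  exact PadicInt.isUnit_iff.mp hu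

/-- **The unit root is `≡ -β (mod 3)`**: for a unit root `z` of `3z⁴ + 3βz³ + 9γz² + 27δz + 9ε`,
reducing `z⁴ + βz³ + 3γz² + 9δz + 3ε = 0` mod `3` gives `z̄³ (z̄ + β̄) = 0`. -/
theorem three_dvd_add_of_psi3III_root {z : ℤ_[3]} (hu : IsUnit z)
    (hz : 3 * z ^ 4 + 3 * β * z ^ 3 + 9 * γ * z ^ 2 + 27 * δ * z + 9 * ε = 0) :
    (3 : ℤ_[3]) ∣ z + β := by
  have h3 : (3 : ℤ_[3]) ≠ 0 := by norm_num
  have hG : z ^ 4 + β * z ^ 3 + 3 * (γ * z ^ 2 + 3 * δ * z + ε) = 0 := by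
    apply mul_left_cancel₀ h3
    linear_combination hz
  rw [three_dvd_iff_toZMod_eq_zero]
  have hbar := congrArg PadicInt.toZMod hG
  simp only [map_add, map_mul, map_pow, map_zero, toZMod_three, zero_mul, add_zero] at hbar
  -- `z̄⁴ + β̄ z̄³ = z̄³ (z̄ + β̄) = 0` with `z̄` a unit
  have hzu : IsUnit (PadicInt.toZMod z ^ 3) := (hu.map PadicInt.toZMod).pow 3
  have : PadicInt.toZMod z ^ 3 * (PadicInt.toZMod z + PadicInt.toZMod (β : ℤ_[3])) = 0 := by
    linear_combination hbar
  rw [map_add]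
  exact (hzu.mul_right_eq_zero).mp this

/-- **Uniqueness of the unit root** (`ℤ₃` is a domain and the difference quotient is a unit):
two unit roots `z₁, z₂` of `3z⁴ + 3βz³ + 9γz² + 27δz + 9ε` coincide — `z₂ = z₁ + 3t` by the
congruence `≡ -β`, and `F(z₁ + 3t) − F(z₁) = 9t·Q` with `Q ≡ 4z₁³ ≢ 0 (mod 3)`.
[cite: SilvermanATAEC1994, IV.9.4 Step 4] -/
theorem eq_of_psi3III_roots {z₁ z₂ : ℤ_[3]} (hu₁ : IsUnit z₁) (hu₂ : IsUnit z₂)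
    (hz₁ : 3 * z₁ ^ 4 + 3 * β * z₁ ^ 3 + 9 * γ * z₁ ^ 2 + 27 * δ * z₁ + 9 * ε = 0)
    (hz₂ : 3 * z₂ ^ 4 + 3 * β * z₂ ^ 3 + 9 * γ * z₂ ^ 2 + 27 * δ * z₂ + 9 * ε = 0) :
    z₁ = z₂ := by
  obtain ⟨t, ht⟩ : (3 : ℤ_[3]) ∣ z₂ - z₁ := by
    have := dvd_sub (three_dvd_add_of_psi3III_root hu₂ hz₂) (three_dvd_add_of_psi3III_root hu₁ hz₁)
    simpa using this
  have ht' : z₂ = z₁ + 3 * t := by linear_combination ht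
  set Q : ℤ_[3] := 4 * z₁ ^ 3 + 3 * (6 * z₁ ^ 2 * t + 12 * z₁ * t ^ 2 + 9 * t ^ 3 + β * z₁ ^ 2
    + 3 * β * z₁ * t + 3 * β * t ^ 2 + 2 * γ * z₁ + 3 * γ * t + 3 * δ) with hQ
  have hprod : 9 * t * Q = 0 := by
    rw [ht'] at hz₂
    linear_combination hz₂ - hz₁
  have hQ0 : Q ≠ 0 := by
    apply (isUnit_of_toZMod_ne_zero ?_).ne_zero
    have hzu : PadicInt.toZMod z₁ ≠ 0 := toZMod_ne_zero_of_isUnit hu₁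
    rw [hQ]
    simp only [map_add, map_mul, map_pow, map_ofNat, show (3 : ZMod 3) = 0 from rfl, zero_mul,
      add_zero, show (4 : ZMod 3) = 1 from rfl, one_mul]
    exact pow_ne_zero 3 hzu
  have h9 : (9 : ℤ_[3]) ≠ 0 := by norm_num
  have ht0 : t = 0 := by
    rcases mul_eq_zero.mp hprod with h | h
    · exact (mul_eq_zero.mp h).resolve_left h9
    · exact absurd h hQ0
  rw [ht', ht0, mul_zero, add_zero]

/-- **The Kummer discriminant of the unit root is a `3`-adic unit**:
`D = 4z³ + 3βz² + 6γz + 9δ ≡ 4z³ ≢ 0 (mod 3)`. -/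
theorem isUnit_disc_of_isUnit {z : ℤ_[3]} (hu : IsUnit z) :
    IsUnit (4 * z ^ 3 + 3 * β * z ^ 2 + 6 * γ * z + 9 * δ : ℤ_[3]) := by
  apply isUnit_of_toZMod_ne_zero
  have hzu : PadicInt.toZMod z ≠ 0 := toZMod_ne_zero_of_isUnit hu
  have e : (4 * z ^ 3 + 3 * β * z ^ 2 + 6 * γ * z + 9 * δ : ℤ_[3]) =
      4 * z ^ 3 + 3 * (β * z ^ 2 + 2 * γ * z + 3 * δ) := by ring
  rw [e]
  simp only [map_add, map_mul, map_pow, map_ofNat, show (3 : ZMod 3) = 0 from rfl, zero_mul,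
    add_zero, show (4 : ZMod 3) = 1 from rfl, one_mul]
  exact pow_ne_zero 3 hzu

end Core

/-! ### §3. The integer `III`-shape translate of the global minimal model -/

/-- The place `placeOf 3` of `ℤ` lies over the rational prime `3`. -/
private theorem natGenerator_placeOf_three : natGenerator (placeOf 3) = 3 :=
  congrArg Subtype.val ((primesEquiv (R := ℤ)).apply_symm_apply ⟨3, Nat.prime_three⟩)

/-- **Tate's normal form, integer version.** For a globally minimal `W/ℚ` with `9 ∥ N` and
`ord₃ Δ_min = 3` (type `III` at `3`) there are integers `r, β, γ, δ, ε` with `3 ∤ ε` such that the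
translate `x ↦ x + r` has `b₂ = 3β`, `b₄ = 3γ`, `b₆ = 9δ`, `b₈ = 9ε`; equivalently
`b₂(W) = 3β − 12r`, `b₄(W) = 3γ − 3βr + 6r²`, `b₆(W) = 9δ − 6γr + 3βr² − 4r³`,
`b₈(W) = 9ε − 27δr + 9γr² − 3βr³ + 3r⁴` (tree K1 bridge `GaloisImage.exists_IIIShape_intModel_three'`:
`3 ∣ b₂`, `3 ∥ b₄`, `9 ∣ b₆`; then `4b₈ = b₂b₆ − b₄²` gives `9 ∥ b₈`).
[cite: SilvermanATAEC1994, IV.9.4 Steps 2–4 (type III)] -/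
theorem exists_IIIShape_coeffs_three (W : WeierstrassCurve ℚ) [W.IsElliptic] [W.IsGloballyMinimal]
    (h9 : 3 ^ 2 ∣ W.conductorNorm ℤ) (h27 : ¬ 3 ^ 3 ∣ W.conductorNorm ℤ)
    (hΔ : padicValInt 3 W.minimalDiscriminantInt = 3) :
    ∃ r β γ δ ε : ℤ, ¬ (3 : ℤ) ∣ ε ∧
      W.b₂ = 3 * β - 12 * r ∧ W.b₄ = 3 * γ - 3 * β * r + 6 * r ^ 2 ∧
      W.b₆ = 9 * δ - 6 * γ * r + 3 * β * r ^ 2 - 4 * r ^ 3 ∧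
      W.b₈ = 9 * ε - 27 * δ * r + 9 * γ * r ^ 2 - 3 * β * r ^ 3 + 3 * r ^ 4 := by
  obtain ⟨V, ⟨r, -, hV⟩, hb₂, hb₄, hb₄', hb₆, -, -⟩ :=
    Summit.BirchSwinnertonDyer.Rank1Residual.GaloisImage.exists_IIIShape_intModel_three' (placeOf 3) W
      natGenerator_placeOf_three
      (kodairaSymbolAt_placeOf_three_eq_III W h9 h27 hΔ)
  have h₂ := congrArg WeierstrassCurve.b₂ hV
  have h₄ := congrArg WeierstrassCurve.b₄ hV
  have h₆ := congrArg WeierstrassCurve.b₆ hV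
  have h₈ := congrArg WeierstrassCurve.b₈ hV
  simp only [map_b₂, map_b₄, map_b₆, map_b₈, eq_intCast, variableChange_b₂, variableChange_b₄,
    variableChange_b₆, variableChange_b₈, inv_one, Units.val_one, one_pow, one_mul] at h₂ h₄ h₆ h₈
  obtain ⟨β, hβ⟩ := hb₂
  obtain ⟨γ, hγ⟩ := hb₄
  obtain ⟨δ, hδ⟩ := hb₆
  -- `9 ∥ b₈` from `4 b₈ = b₂ b₆ − b₄²`
  have hrel := V.b_relation
  have h9b₈ : (9 : ℤ) ∣ V.b₈ := by
    have : (9 : ℤ) ∣ V.b₈ * 4 := ⟨3 * β * δ - γ ^ 2, by rw [mul_comm, hrel, hβ, hγ, hδ]; ring⟩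
    exact (show IsCoprime (9 : ℤ) 4 from ⟨1, -2, by norm_num⟩).dvd_of_dvd_mul_right this
  obtain ⟨ε, hε⟩ := h9b₈
  have hε3 : ¬ (3 : ℤ) ∣ ε := by
    rintro ⟨κ, hκ⟩
    apply hb₄'
    have hγ3 : (3 : ℤ) ∣ γ := by
      refine Int.prime_three.dvd_of_dvd_pow (n := 2) ⟨β * δ - 4 * κ, ?_⟩
      have e : 4 * V.b₈ = V.b₂ * V.b₆ - V.b₄ ^ 2 := hrel
      rw [hε, hκ, hβ, hγ, hδ] at e
      have e9 : (9 : ℤ) * γ ^ 2 = 9 * (3 * (β * δ - 4 * κ)) := by linear_combination e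
      exact mul_left_cancel₀ (by norm_num : (9 : ℤ) ≠ 0) e9
    obtain ⟨μ, hμ⟩ := hγ3
    exact ⟨μ, by rw [hγ, hμ]; ring⟩
  refine ⟨r, β, γ, δ, ε, hε3, ?_, ?_, ?_, ?_⟩
  · rw [hβ] at h₂; push_cast at h₂; linear_combination -h₂
  · rw [hγ] at h₄; rw [hβ] at h₂; push_cast at h₂ h₄; linear_combination -h₄ + (r : ℚ) * h₂
  · rw [hδ] at h₆; rw [hγ] at h₄; rw [hβ] at h₂; push_cast at h₂ h₄ h₆
    linear_combination -h₆ + 2 * (r : ℚ) * h₄ - (r : ℚ) ^ 2 * h₂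
  · rw [hε] at h₈; rw [hδ] at h₆; rw [hγ] at h₄; rw [hβ] at h₂; push_cast at h₂ h₄ h₆ h₈
    linear_combination -h₈ + 3 * (r : ℚ) * h₆ - 3 * (r : ℚ) ^ 2 * h₄ + (r : ℚ) ^ 3 * h₂

end Summit.BirchSwinnertonDyer.BirchSwinnertonDyer.Theorems.ManinLocalTwoThree

end
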